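import Summits.HodgeConjecture.HodgeConjecture.Theorems.SectorComplement.Negative.AnatomyAndKillShape
import Literature.AlgebraicGeometry.HodgeTheory.MotivatedClassesAssembly
import Literature.AlgebraicGeometry.HodgeTheory.MotivatedClassesAlgebraic
import Literature.AlgebraicGeometry.HodgeTheory.HardLefschetzNFoldHolds
import Literature.AlgebraicGeometry.HodgeTheory.ComplexConjugationHolds
import Literature.AlgebraicGeometry.HodgeTheory.MiddleDimensionReductionHolds
import Literature.AlgebraicGeometry.HodgeTheory.LefschetzOneOne
import Literature.AlgebraicGeometry.ShimuraVarieties.BallQuotientHodgeClasses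

/-!
# Strategy census for `EndoscopicMiddleDegree.SectorComplement` (crux stmt-HodgeConjecture-14353) — typed objects

Crux-strategist WALL-BREAKER seat `planner-cstrat-stmt-HodgeConjecture-14353-p1-0`, 2026-08-17. Companion of
`Cruxes/SectorComplement/STRATEGY-CENSUS.md` Part I (same seat). The crux is the route's declared, not-claimed
sector frame `SectorComplement := MiddleDegreeStep → _root_.HodgeConjecture` (auto-crux'd 2026-08-16 on the
docstring words "open problem"). Its truth table and anatomy are LANDED and are CITED here, never re-proved:
`Theorems/SectorComplement/Negative/ReductionToSummit` (`not_sectorComplement_iff : ¬SC ↔ MDS ∧ ¬HC`,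
`sectorComplement_iff_not_middleDegreeStep_or`, `hodgeConjecture_iff_middleDegreeStep_and_sectorComplement`) and
`…/Negative/AnatomyAndKillShape` (p82348: `sectorComplement_iff_offSector_and_calibration`,
`sectorHC_of_middleDegreeStep_of_binders`, `not_sectorComplement_iff_of_nonempty_hodgeModel`,
`sectorComplement_iff_not_hc_imp`).

What this file ADDS, kernel-checked over the tree's REAL declarations (no propositional stand-ins):

* §L the LAW OF LINES for this crux and the tautology behind the "given one piece the other is the crux"
  objection (`composition_iff`, `other_piece_iff_summit_of_one`) — it holds for EVERY decomposition of the
  summit into HC-implied pieces, so it is not evidence that a piece restates the crux;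
* §C the CALIBRATION SHARPENED from four binders to two: Hodge models and the hard-Lefschetz reduction are
  now THEOREMS of the tree (`nonempty_hodgeModel_holds`, `mem_algebraicClasses_of_lt_of_nonempty` +
  `nonempty_hardLefschetzNFold_holds`), so full HC on the sector follows from `MiddleDegreeStep`, Lefschetz
  (1,1) (`lefschetzOneOne_rational`) and BMM Cor. 2 (`bmm2016_hodge_offMiddleThird`) alone
  (`sectorHC_of_middleDegreeStep`);
* §D the ANDRÉ SEAM typed for THIS route, with André's bridge "under `B`, motivated ⇒ algebraic" discharged by
  the route's OWN support item `CupProductAlgebraic` (stmt-14350) through the tree theorem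
  `Andre1996_motivatedClasses_le_algebraicClasses_of_standardConjectureB_holds_of`
  (`sectorComplement_of_andreSeam : CupProductAlgebraic → LefschetzBAll → HodgeIsMotivatedAll → SC`,
  `MiddleDegreeStep` idle), and the RIGID-SECTOR DISCHARGE: what the crux's hypothesis actually pays for in
  that seam is motivated-ness of the Hodge classes ON the sector (`hodgeIsMotivated_onSector_of_middleDegreeStep`)
  — exactly the anchor-less (Calabi–Vesentini rigid) members where André's deformation principle cannot act;
* §S the STRENGTHENING LAW (`strengthening_law : (S → SC) → (HC → S) → (S ∧ MDS ↔ HC)`) and its instance the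
  motivated summit;
* §N the OFF-SECTOR SHAPE OF ANY KILL: modulo Lefschetz (1,1) and BMM Cor. 2, a refutation must PROVE the
  target and exhibit a non-algebraic rational Hodge class on a smooth projective variety carrying NO
  ball-quotient datum of its own dimension in {4, 6} (`not_sectorComplement_offSector_shape`), and, in degree
  coordinates, a non-algebraic MIDDLE class on an even-dimensional variety (`not_sectorComplement_middle_shape`,
  unconditional, BFNP Lemma 48 = `middleDimensionReduction_holds`).

Everything is sorry-free. Nothing here asserts a Theses decl; no `stub_*` is declared (this is NOT a line).
-/

set_option linter.dupNamespace false

namespace Summit.HodgeConjecture.HodgeConjecture.Cruxes.SectorComplement.StrategyCensus.EndoscopicMiddleDegree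

open Summit.HodgeConjecture.HodgeConjecture.Theses.EndoscopicMiddleDegree
open Summit.HodgeConjecture.HodgeConjecture.Theorems.SectorComplement.Negative
open Literature.AlgebraicGeometry.HodgeTheory Literature.AlgebraicGeometry.Motives
  Literature.AlgebraicGeometry.ShimuraVarieties
open CategoryTheory MonoidalCategory

/-! ## §0 Abbreviations (workfile-only `def`s) -/

/-- FULL Hodge conjecture on the sector (all degrees, with the model conjunct), `m ∈ {1, 2}`. [folklore] -/
def SectorHC : Prop :=
  ∀ (m : ℕ) (X : SchemeOver ℂ), 1 ≤ m → m ≤ 2 →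
    Nonempty (UnitaryBallQuotientDatum (2 * (m + 1)) X) → HodgeConjectureFor (2 * (m + 1)) X

/-- The HONEST off-sector frame: full HC on the sector implies HC. [folklore] -/
def HonestOffSector : Prop :=
  SectorHC → _root_.HodgeConjecture

/-- Grothendieck's standard conjecture of Lefschetz type for ALL smooth projective complex varieties, in the
tree's `*_L`-form `StandardConjectureBStar` (André 1996 §0.3; = `B(X)` by André Prop. 1.2). Open; KNOWN for
abelian varieties (Lieberman 1968 — the tree's `Motives.standardConjectureB_abelianVariety_holds` for any Weil
cohomology with hard Lefschetz), curves, surfaces, flag varieties, complete intersections.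
[cite: Andre1996Motifs, §0.3] [cite: Kleiman1968, §2 Appendix] -/
def LefschetzBAll : Prop :=
  ∀ (d : ℕ) (Z : SchemeOver ℂ) (η : complexBetti Z 2), IsSmoothProjective d Z → StandardConjectureBStar d Z η

/-- "Every Hodge class is motivated" for ALL smooth projective complex varieties (André 1996 §0.4; KNOWN for
abelian varieties, Thm. 0.6.2 = tree fact `Andre1996_hodgeClasses_abelianVariety_motivated`; in the Lefschetz
range, tree `mem_motivatedClasses_of_lefschetzRange`; deformation-invariant along connected smooth projective
families, Thm. 0.5 = tree fact `Andre1996_deformation`). [cite: Andre1996Motifs, §0.4, Thm. 0.5, Thm. 0.6.2] -/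
def HodgeIsMotivatedAll : Prop :=
  ∀ ⦃n : ℕ⦄ ⦃X : SchemeOver ℂ⦄, IsSmoothProjective n X → ∀ (p : ℕ) (c : complexBetti X (2 * p)),
    IsRationalClass c → IsOfHodgeType n X (2 * p) p p c → c ∈ motivatedClasses n X p

/-! ## §L The law of lines, and the tautology behind objection "(b)" -/

/-- LAW OF LINES for this crux: a stub set `S` concludes the frame iff `S` together with the route's own
target proves the formal Hodge conjecture. (Re-derived; first kernel-checked in `FunnelSalvage.composition_iff`.)
[folklore] -/
theorem composition_iff (S : Prop) :
    (S → SectorComplement) ↔ (S ∧ MiddleDegreeStep → _root_.HodgeConjecture) :=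
  ⟨fun h hs ↦ h hs.1 hs.2, fun h hs hM ↦ h ⟨hs, hM⟩⟩

/-- Every concluding stub set realises the disjunction "refute the target or prove the summit". [folklore] -/
theorem composition_dichotomy {S : Prop} (h : S → SectorComplement) (hs : S) :
    ¬ MiddleDegreeStep ∨ _root_.HodgeConjecture :=
  sectorComplement_iff_not_middleDegreeStep_or.1 (h hs)

/-- THE TAUTOLOGY behind the objection "given one piece, the other piece IS the crux/summit": for ANY two-piece
decomposition `A → B → SectorComplement` whose second piece is HC-implied, granting `A` and the target makes
`B ↔ HC`. This holds for every decomposition of the summit into necessary pieces whatsoever, so it carries no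
information about whether `B` "restates" the summit; the informative test is EVIDENCE-INDEPENDENCE (is `B` known
in a case where HC is open?), which is a statement about the literature, not a theorem. [folklore] -/
theorem other_piece_iff_summit_of_one {A B : Prop} (h : A → B → SectorComplement)
    (hB : _root_.HodgeConjecture → B) (hA : A) (hM : MiddleDegreeStep) : B ↔ _root_.HodgeConjecture :=
  ⟨fun hb ↦ h hA hb hM, hB⟩

/-- … and symmetrically the conjunction of the pieces with the target is the summit. [folklore] -/
theorem pieces_and_target_iff_summit {A B : Prop} (h : A → B → SectorComplement)
    (hA : _root_.HodgeConjecture → A) (hB : _root_.HodgeConjecture → B) :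
    (A ∧ B ∧ MiddleDegreeStep) ↔ _root_.HodgeConjecture :=
  ⟨fun ⟨ha, hb, hM⟩ ↦ h ha hb hM, fun hc ↦ ⟨hA hc, hB hc,
    fun m X _ _ hD _ c hc' hH ↦ by obtain ⟨D⟩ := hD; exact (hc D.isSmoothProjective).2 (m + 1) c hc' hH⟩⟩

/-! ## §C Calibration sharpened: two binders instead of four -/

/-- FULL HC ON THE SECTOR from the target and TWO printed theorems taken as binders — Lefschetz (1,1)
(`lefschetzOneOne_rational`, Voisin I Thm. 11.30) and BMM Cor. 2 (`bmm2016_hodge_offMiddleThird`,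
arXiv:1306.1515, at `(p, n) = (6, 2)`: `3·2 ≤ 6`) — the other two binders of the landed
`sectorHC_of_middleDegreeStep_of_binders` being THEOREMS of the tree now: Hodge models
(`nonempty_hodgeModel_holds`) and the hard-Lefschetz reduction (`mem_algebraicClasses_of_lt_of_nonempty` with
`nonempty_hardLefschetzNFold_holds`). [cite: BergeronMillsonMoeglin2016Balls, Cor. 2] [cite: VoisinHodgeI2002, Thm. 11.30, Thm. 6.25] -/
theorem sectorHC_of_middleDegreeStep (hL : lefschetzOneOne_rational) (hBMM : bmm2016_hodge_offMiddleThird)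
    (hMid : MiddleDegreeStep) : SectorHC := by
  refine sectorHC_of_middleDegreeStep_of_binders (fun N X hX ↦ hL hX)
    (fun N X hX p hp hyp c hc hH ↦ ?_) (fun N X hX ↦ nonempty_hodgeModel_holds hX) (fun X hD ↦ ?_) hMid
  · exact mem_algebraicClasses_of_lt_of_nonempty (nonempty_hardLefschetzNFold_holds N X) hX hp hyp c hc hH
  · obtain ⟨D⟩ := id hD
    exact hBMM (2 * (2 + 1)) X hD D.isSmoothProjective 2 (by norm_num) (Or.inl (by norm_num))

/-- Hence, modulo those two printed theorems, the crux IS its honest part `SectorHC → HC`. [folklore] -/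
theorem sectorComplement_iff_honest (hL : lefschetzOneOne_rational) (hBMM : bmm2016_hodge_offMiddleThird) :
    SectorComplement ↔ HonestOffSector := by
  constructor
  · intro hS hSec
    exact hS fun m X h1 h2 hD _ c hc hH ↦ (hSec m X h1 h2 hD).2 (m + 1) c hc hH
  · intro h hM
    exact h (sectorHC_of_middleDegreeStep hL hBMM hM)

/-- D0, the CALIBRATION SPLIT `Calibration → HonestOffSector → SectorComplement` (children: "MDS ⟹ full HC on
the sector" and "full HC on the sector ⟹ HC"): residual-free as logic, but its second child is the crux's
honest reading — given the (now two-binder) calibration it is EQUIVALENT to the crux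
(`sectorComplement_iff_honest`). [folklore] -/
theorem sectorComplement_of_calibrationSplit (h₁ : MiddleDegreeStep → SectorHC) (h₂ : HonestOffSector) :
    SectorComplement :=
  fun hM ↦ h₂ (h₁ hM)

/-! ## §D The André seam, typed for this route -/

/-- The route's own support item `CupProductAlgebraic` (stmt-HodgeConjecture-14350, Fulton §19.2 / Voisin II
Prop. 9.20) IS the Literature input `Voisin2003_cupProduct_algebraicClasses` of André's bridge (same statement
up to binder explicitness). [cite: VoisinHodgeII2003, Prop. 9.20] -/
theorem cupFact_of_cupProductAlgebraic (h : CupProductAlgebraic) : Voisin2003_cupProduct_algebraicClasses :=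
  fun _ _ hV a b x y hx hy ↦ h hV a b x y hx hy

/-- André's bridge "under `B` for all varieties, motivated classes are algebraic" from the route's own item
(tree theorem `…_holds_of`). [cite: Andre1996Motifs, §2.1 remark following Déf. 1] -/
theorem andreBridge_of_cupProductAlgebraic (h : CupProductAlgebraic) :
    Andre1996_motivatedClasses_le_algebraicClasses_of_standardConjectureB :=
  Andre1996_motivatedClasses_le_algebraicClasses_of_standardConjectureB_holds_of (cupFact_of_cupProductAlgebraic h)

/-- THE SEAM CLOSES THE SUMMIT: `CupProductAlgebraic → LefschetzBAll → HodgeIsMotivatedAll → HC` — Hodge ⇒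
motivated ⇒ (under `B`) algebraic; the model conjunct by `nonempty_hodgeModel_holds`.
[cite: Andre1996Motifs, §0.3–0.4 and §2.1] -/
theorem hodgeConjecture_of_andreSeam (hcup : CupProductAlgebraic) (hB : LefschetzBAll)
    (hM : HodgeIsMotivatedAll) : _root_.HodgeConjecture :=
  fun _ _ hX ↦ ⟨nonempty_hodgeModel_holds hX,
    fun p c hc hpp ↦ andreBridge_of_cupProductAlgebraic hcup hB hX p (hM hX p c hc hpp)⟩

/-- D2, the ANDRÉ SPLIT of the crux: `CupProductAlgebraic → LefschetzBAll → HodgeIsMotivatedAll → SectorComplement`.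
Residual-free, no child restates the crux on EVIDENCE (B and Hodge ⇒ motivated are both KNOWN for abelian
varieties, where HC is open from Weil-type sixfolds up) — and the crux's hypothesis `MiddleDegreeStep` is NOT
used: it is a decomposition of the SUMMIT (shape (P) of IdeatorFiveNotes §0), not of this step.
[cite: Andre1996Motifs, §0.4] -/
theorem sectorComplement_of_andreSeam (hcup : CupProductAlgebraic) (hB : LefschetzBAll)
    (hM : HodgeIsMotivatedAll) : SectorComplement :=
  fun _ ↦ hodgeConjecture_of_andreSeam hcup hB hM

/-- `HC → HodgeIsMotivatedAll`, unconditionally in the tree (algebraic ⇒ motivated, hard Lefschetz of `X ⊗ X`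
being the theorem `nonempty_hardLefschetzNFold_holds`). [cite: Andre1996Motifs, §2.1 remark after Déf. 1] -/
theorem hodgeIsMotivatedAll_of_hodgeConjecture (h : _root_.HodgeConjecture) : HodgeIsMotivatedAll :=
  fun _ _ hX p c hc hpp ↦
    algebraicClasses_le_motivatedClasses_of_nonempty_hardLefschetzNFold hX
      (nonempty_hardLefschetzNFold_holds _ _) p ((h hX).2 p c hc hpp)

/-- The tautology of §L instantiated: granted `B` (and the cup-product item), the motivated piece, the crux-with-
its-target and the summit coincide — as they must for ANY complete decomposition. [cite: Andre1996Motifs, §0.4] -/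
theorem hodgeIsMotivatedAll_iff_hodgeConjecture_of_B (hcup : CupProductAlgebraic) (hB : LefschetzBAll) :
    HodgeIsMotivatedAll ↔ _root_.HodgeConjecture :=
  ⟨hodgeConjecture_of_andreSeam hcup hB, hodgeIsMotivatedAll_of_hodgeConjecture⟩

/-- EVIDENCE-INDEPENDENCE, the half that IS a tree statement: the motivated piece holds on every abelian variety
by André's Thm. 0.6.2 (named fact), a class of varieties on which HC is open (Weil type, dimension ≥ 6); the
other half — `B` for abelian varieties — is the tree THEOREM `Motives.standardConjectureB_abelianVariety_holds`
(abstract Weil cohomology with hard Lefschetz; Lieberman 1968). So neither child of D2 is the summit reworded.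
[cite: Andre1996Motifs, Thm. 0.6.2] -/
theorem hodgeIsMotivated_abelianVariety (hA : Andre1996_hodgeClasses_abelianVariety_motivated)
    (A : AbelianVariety ℂ) (hAsp : IsSmoothProjective A.dim A.X) (p : ℕ) (c : complexBetti A.X (2 * p))
    (hc : IsRationalClass c) (hpp : IsOfHodgeType A.dim A.X (2 * p) p p c) : c ∈ motivatedClasses A.dim A.X p :=
  hA A hAsp p c hc hpp

/-- THE RIGID-SECTOR DISCHARGE — what `MiddleDegreeStep` actually pays for in the André seam. On the sector
(compact arithmetic ball quotients: infinitesimally rigid by Calabi–Vesentini, so André's deformation principle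
Thm. 0.5 has no family to act on and every Hodge class needs its OWN anchor), the target plus the two binders of
§C make every rational Hodge class algebraic, hence motivated. So in the seam `B ∧ (Hodge ⇒ motivated)` the
crux's hypothesis discharges exactly the conjunct "Hodge ⇒ motivated ON THE SECTOR" — a measure-zero, rigid
part of `HodgeIsMotivatedAll` — and nothing off the sector. [cite: Andre1996Motifs, Thm. 0.5 and §2.1]
[cite: BergeronMillsonMoeglin2016Balls, Cor. 2] -/
theorem hodgeIsMotivated_onSector_of_middleDegreeStep (hL : lefschetzOneOne_rational)
    (hBMM : bmm2016_hodge_offMiddleThird) (hMid : MiddleDegreeStep) :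
    ∀ (m : ℕ) (X : SchemeOver ℂ), 1 ≤ m → m ≤ 2 → Nonempty (UnitaryBallQuotientDatum (2 * (m + 1)) X) →
      ∀ (p : ℕ) (c : complexBetti X (2 * p)), IsRationalClass c →
        IsOfHodgeType (2 * (m + 1)) X (2 * p) p p c → c ∈ motivatedClasses (2 * (m + 1)) X p := by
  intro m X h1 h2 hD p c hc hpp
  obtain ⟨D⟩ := id hD
  have hX : IsSmoothProjective (2 * (m + 1)) X := D.isSmoothProjective
  exact algebraicClasses_le_motivatedClasses_of_nonempty_hardLefschetzNFold hX
    (nonempty_hardLefschetzNFold_holds _ _) p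
    ((sectorHC_of_middleDegreeStep hL hBMM hMid m X h1 h2 hD).2 p c hc hpp)

/-- "Hodge ⇒ motivated" OFF the sector: for varieties carrying no ball-quotient datum of dimension 4 or 6.
[folklore] -/
def HodgeIsMotivatedOffSector : Prop :=
  ∀ ⦃n : ℕ⦄ ⦃X : SchemeOver ℂ⦄, IsSmoothProjective n X →
    (∀ m : ℕ, 1 ≤ m → m ≤ 2 → 2 * (m + 1) = n → IsEmpty (UnitaryBallQuotientDatum (2 * (m + 1)) X)) →
    ∀ (p : ℕ) (c : complexBetti X (2 * p)), IsRationalClass c → IsOfHodgeType n X (2 * p) p p c →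
      c ∈ motivatedClasses n X p

/-- The MDS-USING form of the André split: `HodgeIsMotivatedAll` is the off-sector piece plus what the target
delivers on the sector (modulo the two binders) — provided a datum pins the dimension of `X` (hypothesis
`hdim`: a `UnitaryBallQuotientDatum k X` on a smooth projective `X` of dimension `n` forces `k = n`; true — both
record `IsSmoothProjective _ X` of the irreducible `X` — and taken as a binder to keep this file elementary).
This is the ONLY place the crux's hypothesis can bear load in a summit decomposition, and the piece it removes
is the rigid sector itself. [folklore] -/
theorem hodgeIsMotivatedAll_of_offSector (hL : lefschetzOneOne_rational) (hBMM : bmm2016_hodge_offMiddleThird)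
    (hdim : ∀ (n k : ℕ) (X : SchemeOver ℂ), IsSmoothProjective n X →
      Nonempty (UnitaryBallQuotientDatum k X) → k = n)
    (hMid : MiddleDegreeStep) (hOff : HodgeIsMotivatedOffSector) : HodgeIsMotivatedAll := by
  intro n X hX p c hc hpp
  by_cases hsec : ∃ m : ℕ, 1 ≤ m ∧ m ≤ 2 ∧ Nonempty (UnitaryBallQuotientDatum (2 * (m + 1)) X)
  · obtain ⟨m, h1, h2, hD⟩ := hsec
    obtain rfl : 2 * (m + 1) = n := hdim n _ X hX hD
    exact hodgeIsMotivated_onSector_of_middleDegreeStep hL hBMM hMid m X h1 h2 hD p c hc hpp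
  · push Not at hsec
    exact hOff hX (fun m h1 h2 _ ↦ hsec m h1 h2) p c hc hpp

/-- … so the MDS-using André split reads `CupProductAlgebraic → LefschetzBAll → HodgeIsMotivatedOffSector →
SectorComplement` (modulo the binders): the crux's hypothesis is consumed, but only to motivate the sector's own
classes; the off-sector piece is "Hodge ⇒ motivated" for every other variety — a summit-level conjecture with a
measure-zero exclusion, i.e. André's conjecture in costume, owned summit-wide. [cite: Andre1996Motifs, §0.4] -/
theorem sectorComplement_of_andreSeam_offSector (hL : lefschetzOneOne_rational)
    (hBMM : bmm2016_hodge_offMiddleThird)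
    (hdim : ∀ (n k : ℕ) (X : SchemeOver ℂ), IsSmoothProjective n X →
      Nonempty (UnitaryBallQuotientDatum k X) → k = n)
    (hcup : CupProductAlgebraic) (hB : LefschetzBAll) (hOff : HodgeIsMotivatedOffSector) : SectorComplement :=
  fun hMid ↦ hodgeConjecture_of_andreSeam hcup hB (hodgeIsMotivatedAll_of_offSector hL hBMM hdim hMid hOff)

/-! ## §S Strengthenings: the law and the motivated summit -/

/-- THE STRENGTHENING LAW for this crux: any `S⁺` that implies the frame and is implied by HC satisfies
`S⁺ ∧ MiddleDegreeStep ↔ HC` — modulo the (HC-implied, open) target it IS the summit. [folklore] -/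
theorem strengthening_law {S : Prop} (h₁ : S → SectorComplement) (h₂ : _root_.HodgeConjecture → S) :
    S ∧ MiddleDegreeStep ↔ _root_.HodgeConjecture :=
  ⟨fun h ↦ h₁ h.1 h.2, fun h ↦ ⟨h₂ h, (hodgeConjecture_iff_middleDegreeStep_and_sectorComplement.1 h).1⟩⟩

/-- A strengthening NOT implied by HC is a bet beyond the Clay problem; the only HC-free way into the frame is
`¬ MiddleDegreeStep`, a refutation of HC on the sector (`Negative.not_hodgeConjecture_of_not_middleDegreeStep`).
[folklore] -/
theorem strengthening_dichotomy {S : Prop} (h₁ : S → SectorComplement) (hS : S) :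
    ¬ MiddleDegreeStep ∨ _root_.HodgeConjecture :=
  composition_dichotomy h₁ hS

/-- S⁺₂, the MOTIVATED SUMMIT `B ∧ (Hodge ⇒ motivated)` for all varieties. -/
def MotivatedSummit : Prop := LefschetzBAll ∧ HodgeIsMotivatedAll

/-- S⁺₂ implies the frame (modulo the route's cup-product item), `MiddleDegreeStep` idle; with
`strengthening_law` it is the summit modulo the target. [cite: Andre1996Motifs, §0.4] -/
theorem sectorComplement_of_motivatedSummit (hcup : CupProductAlgebraic) (h : MotivatedSummit) :
    SectorComplement :=
  sectorComplement_of_andreSeam hcup h.1 h.2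

/-- S⁺₁, the DATUM-FREE frame: middle-degree propagation on EVERY smooth projective 4- and 6-fold implies HC.
Weaker than the crux as a frame (stronger antecedent), still HC-implied, still refutable only with `¬HC`
(`Negative.not_frame_iff`). [folklore] -/
theorem datumFreeFrame_of_sectorComplement (h : SectorComplement) :
    (∀ (m : ℕ) (X : SchemeOver ℂ), 1 ≤ m → m ≤ 2 → IsSmoothProjective (2 * (m + 1)) X →
      (∀ a : complexBetti X (2 * m), IsRationalClass a →
        IsOfHodgeType (2 * (m + 1)) X (2 * m) m m a → a ∈ algebraicClasses X m) →
      ∀ c : complexBetti X (2 * (m + 1)), IsRationalClass c →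
        IsOfHodgeType (2 * (m + 1)) X (2 * (m + 1)) (m + 1) (m + 1) c → c ∈ algebraicClasses X (m + 1)) →
    _root_.HodgeConjecture := by
  intro hAll
  refine h fun m X h1 h2 hD hlow c hc hH ↦ ?_
  obtain ⟨D⟩ := hD
  exact hAll m X h1 h2 D.isSmoothProjective hlow c hc hH

/-! ## §N Negation: the shape of a counterexample, one step beyond the landed kill shape -/

/-- OFF-SECTOR SHAPE OF ANY KILL. Modulo Lefschetz (1,1) and BMM Cor. 2 (binders) and the dimension pin `hdim`,
a refutation of the crux must PROVE the target AND exhibit a non-algebraic rational Hodge class on a smooth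
projective variety that carries NO `UnitaryBallQuotientDatum` in dimension 4 or 6 — the honest counterexample
lives off the sector, where nothing the route knows reaches. (Landed: `¬SC ↔ MDS ∧ honest cex` modulo Hodge
models, now a theorem.) [folklore] -/
theorem not_sectorComplement_offSector_shape (hL : lefschetzOneOne_rational)
    (hBMM : bmm2016_hodge_offMiddleThird)
    (hdim : ∀ (n k : ℕ) (X : SchemeOver ℂ), IsSmoothProjective n X →
      Nonempty (UnitaryBallQuotientDatum k X) → k = n)
    (h : ¬ SectorComplement) :
    MiddleDegreeStep ∧ ∃ (n : ℕ) (X : SchemeOver ℂ) (p : ℕ) (c : complexBetti X (2 * p)),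
      IsSmoothProjective n X ∧
      (∀ m : ℕ, 1 ≤ m → m ≤ 2 → IsEmpty (UnitaryBallQuotientDatum (2 * (m + 1)) X)) ∧
      IsRationalClass c ∧ IsOfHodgeType n X (2 * p) p p c ∧ c ∉ algebraicClasses X p := by
  obtain ⟨hM, n, X, p, c, hX, hc, hH, hnot⟩ :=
    (not_sectorComplement_iff_of_nonempty_hodgeModel (fun n X ↦ nonempty_hodgeModel_holds)).1 h
  refine ⟨hM, n, X, p, c, hX, fun m h1 h2 ↦ ?_, hc, hH, hnot⟩
  by_contra hne
  rw [not_isEmpty_iff] at hne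
  obtain rfl : 2 * (m + 1) = n := hdim n _ X hX hne
  exact hnot ((sectorHC_of_middleDegreeStep hL hBMM hM m X h1 h2 hne).2 p c hc hH)

/-- `MiddleAll`: every rational middle-degree Hodge class on every even-dimensional smooth projective complex
variety is algebraic (BFNP 2009 Lemma 48, cycle part). [cite: BrosnanFangNiePearlstein2009, Lemma 48] -/
def MiddleAll : Prop :=
  ∀ ⦃m : ℕ⦄ ⦃X : SchemeOver ℂ⦄, IsSmoothProjective (2 * m) X →
    ∀ c : complexBetti X (2 * m), IsRationalClass c → IsOfHodgeType (2 * m) X (2 * m) m m c →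
      c ∈ algebraicClasses X m

/-- `HC ↔ MiddleAll`, UNCONDITIONALLY in the tree (`middleDimensionReduction_holds` + `nonempty_hodgeModel_holds`).
[cite: BrosnanFangNiePearlstein2009, Lemma 48] -/
theorem hodgeConjecture_iff_middleAll : _root_.HodgeConjecture ↔ MiddleAll :=
  ⟨fun h m _ hX c hc hpp ↦ (h hX).2 m c hc hpp,
    fun h _ _ hX ↦ hodgeConjectureFor_of_middleDimension_holds h hX⟩

/-- D1, the DEGREE SPLIT: the crux in degree coordinates is `MiddleDegreeStep → MiddleAll` — middle classes on
compact arithmetic 4- and 6-ball quotients ⟹ middle classes on ALL even-dimensional varieties. [folklore] -/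
theorem sectorComplement_iff_mds_imp_middleAll : SectorComplement ↔ (MiddleDegreeStep → MiddleAll) :=
  ⟨fun h hM ↦ hodgeConjecture_iff_middleAll.1 (h hM), fun h hM ↦ hodgeConjecture_iff_middleAll.2 (h hM)⟩

/-- Degree shape of a kill, unconditional: prove the target AND exhibit a non-algebraic rational MIDDLE class on
an even-dimensional smooth projective variety. [cite: BrosnanFangNiePearlstein2009, Lemma 48] -/
theorem not_sectorComplement_middle_shape (h : ¬ SectorComplement) : MiddleDegreeStep ∧ ¬ MiddleAll :=
  let ⟨hM, hHC⟩ := not_sectorComplement_iff.1 h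
  ⟨hM, fun hm ↦ hHC (hodgeConjecture_iff_middleAll.2 hm)⟩

end Summit.HodgeConjecture.HodgeConjecture.Cruxes.SectorComplement.StrategyCensus.EndoscopicMiddleDegree
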